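import Mathlib
import Literature.Analysis.Complex.CauchyTransform
import Literature.Analysis.Complex.CauchyPompeiu
import Literature.Analysis.Complex.CauchyTransformHolderHigher
import Literature.Analysis.FunctionSpaces.ContDiffHolderSpace
import Literature.Analysis.FunctionSpaces.ContDiffHolderLocalization
import Literature.Analysis.FunctionSpaces.ContDiffHolderCompactInclusion
import Literature.Analysis.FunctionSpaces.HolderAlgebra
import Literature.Geometry.Symplectic.JHolomorphicMap
import Summits.SmoothPoincare4.SmoothPoincare4.Theorems.SullivanDualTameOrBrodyR4PencilDefs
import Summits.SmoothPoincare4.SmoothPoincare4.Theorems.SullivanDualTameOrBrodyR4CoreAOperators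
import Summits.SmoothPoincare4.SmoothPoincare4.Theorems.SullivanDualTameOrBrodyR4CoreAChart
import Summits.SmoothPoincare4.SmoothPoincare4.Theorems.SullivanDualTameOrBrodyR4HelperConjugatedEquation
import Summits.SmoothPoincare4.SmoothPoincare4.Theorems.SullivanDualTameOrBrodyR4HelperMemberToZeroAux

/-!
# A member close to the centre is a small zero of the vorticity map
# (stub `helper_memberToZero`, line Sketch)

Crux `stmt-SmoothPoincare4-7826` (`TameOrBrodyR4`), line `Sketch`, CORE-A (local uniqueness half
of the implicit-function-theorem chart at a pencil member `u₀`, chart data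
`𝒞 : CoreA.ChartData …`). Given `ε > 0` we find `θ > 0` such that every member `u` of value
`b₀ + β` which is `θ`-close to `u₀` (uniformly on `ℂ`, and in `C¹` and `C^{1,r}` on the disc of
radius `ρ₁ + 3`) is, in the normal form `u = u₀ + Ψ w̃`, `w̃ = Ψ⁻¹ (u - u₀)`, a SMALL ZERO of the
vorticity map: `g := ∂̄ w̃` is a `C^{0,r}_b` density with `‖g‖ ≤ ε`, vanishing for
`‖x‖ ≥ ρ₁ + 1`, `w̃ = (0, β) + T (χ₁ g)` (`T` the Cauchy transform) and
`g + χ · ½ (A w̃ + N(w̃)) = 0`.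

Proof.
* The conjugated Cauchy–Riemann equation (`helper_conjugatedEquation`, direction `→`: `u` is
  flat-`J`-holomorphic) reads `2 ∂̄ w̃ + A w̃ + N(w̃) = 0`; for `‖ξ‖ ≥ ρ₁ + 1` the coefficient
  `A` vanishes (`CoreA.ChartData.A_eq_zero`) and `J (u ξ) = J (u₀ ξ)` (both points lie in
  `‖x‖ ≥ R`, where `J` is standard), so `∂̄ w̃ = 0` there: `g` is smooth with compact support,
  hence in `C^{0,r}_b`, and `χ₁ g = g`.
* `‖g‖_{C^{0,r}} ≤ 2 K θ ≤ ε` by the quantitative half `helper_memberToZeroAux`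
  (`…HelperMemberToZeroAux.lean`).
* `k := w̃ - (0, β) - T g` is smooth with `∂̄ k = 0` (`∂̄ T g = g`) and `k → 0` at infinity (the
  tails of the two members, `MemberToZero.tendsto_normalForm`, and `T g → 0`), so `k = 0` by the
  vector Liouville theorem `MemberToZero.eq_zero_of_dbar_eq_zero`.
* The zero equation is the conjugated equation divided by `2` where `χ = 1`, and `0 = 0`
  elsewhere (`MemberToZero.zero_equation_of`).
-/

-- the registered namespace `Summit.SmoothPoincare4.SmoothPoincare4.…` repeats a component
set_option linter.dupNamespace false

noncomputable section

open scoped ContDiff Topology NNReal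
open Filter Set Metric Literature.Analysis.Complex Literature.Analysis.FunctionSpaces
  Literature.Geometry.Symplectic

namespace Summit.SmoothPoincare4.SmoothPoincare4.Cruxes.TameOrBrodyR4.Sketch

/-- Local notation for the model space `ℝ⁴ = EuclideanSpace ℝ (Fin 4)`. -/
local notation "E4" => EuclideanSpace ℝ (Fin 4)

/-- **Stub `helper_memberToZero` (MZ).** For chart data `𝒞` at the member `u₀` and `ε > 0` there
is `θ > 0` such that every member `u` of value `b₀ + β` which is `θ`-close to `u₀` (uniformly on
`ℂ`, and in `C¹` and `C^{1,r}` on the closed disc of radius `ρ₁ + 3`) is a small zero of the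
vorticity map in normal form: `g := ∂̄ (Ψ⁻¹ (u - u₀))` is a `C^{0,r}_b` density of norm `≤ ε`
vanishing for `‖x‖ ≥ ρ₁ + 1`, `u = u₀ + Ψ ((0, β) + T (χ₁ g))`, and
`g + χ · ½ (A W + N(W)) = 0` with `W = (0, β) + T (χ₁ g)`. -/
theorem helper_memberToZero (J : E4 → E4 →L[ℝ] E4) (R : ℝ) (P Q : E4 →L[ℝ] ℂ) (eP eQ : ℂ →L[ℝ] E4)
    (hR : 0 < R) (hJs : ContDiff ℝ ∞ J) (hJ2 : ∀ x v, J x (J x v) = -v)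
    (hPQ : IsCoordFrame P Q eP eQ)
    (hJP : ∀ x : E4, R ≤ ‖x‖ → ∀ v, P (J x v) = Complex.I * P v)
    (hJQ : ∀ x : E4, R ≤ ‖x‖ → ∀ v, Q (J x v) = Complex.I * Q v)
    {r : ℝ≥0} (hr0 : 0 < r) (hr1 : r < 1)
    (b₀ : ℂ) (u₀ : ℂ → E4) (hu₀ : IsPencilMember J R P Q b₀ u₀)
    (𝒞 : CoreA.ChartData J R P Q eP eQ b₀ u₀) (ε : ℝ) (hε : 0 < ε) :
    ∃ θ > (0 : ℝ), ∀ (β : ℂ) (u : ℂ → E4), IsPencilMember J R P Q (b₀ + β) u → ‖β‖ < θ →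
      (∀ ξ, ‖u ξ - u₀ ξ‖ ≤ θ) →
      (∀ ξ ∈ closedBall (0 : ℂ) (𝒞.ρ₁ + 3), ‖fderiv ℝ u ξ - fderiv ℝ u₀ ξ‖ ≤ θ) →
      (∀ ξ ∈ closedBall (0 : ℂ) (𝒞.ρ₁ + 3), ∀ ξ' ∈ closedBall (0 : ℂ) (𝒞.ρ₁ + 3),
        ‖(fderiv ℝ u ξ - fderiv ℝ u₀ ξ) - (fderiv ℝ u ξ' - fderiv ℝ u₀ ξ')‖ ≤
          θ * ‖ξ - ξ'‖ ^ (r : ℝ)) →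
      ∃ g : ContDiffHolderFunction ℂ (ℂ × ℂ) 0 r, ‖g‖ ≤ ε ∧
        (∀ x, 𝒞.ρ₁ + 1 ≤ ‖x‖ → g x = 0) ∧
        (∀ x, g x = dbarAlong (1 : ℂ) (fun y => 𝒞.Ψinv y (u y - u₀ y)) x) ∧
        (∀ ξ, u ξ = u₀ ξ + 𝒞.Ψ ξ (((0 : ℂ), β) +
          cauchyTransformAlong (1 : ℂ) (fun w => 𝒞.χ₁ w • g w) ξ)) ∧
        (∀ x : ℂ, g x + 𝒞.χ x • (1 / 2 : ℝ) •
          (𝒞.A x (((0 : ℂ), β) + cauchyTransformAlong (1 : ℂ) (fun w => 𝒞.χ₁ w • g w) x) +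
            𝒞.Ψinv x ((J (u₀ x + 𝒞.Ψ x (((0 : ℂ), β) +
                cauchyTransformAlong (1 : ℂ) (fun w => 𝒞.χ₁ w • g w) x)) - J (u₀ x))
              (fderiv ℝ u₀ x Complex.I + (fderiv ℝ 𝒞.Ψ x Complex.I)
                (((0 : ℂ), β) + cauchyTransformAlong (1 : ℂ) (fun w => 𝒞.χ₁ w • g w) x) +
                𝒞.Ψ x (fderiv ℝ (fun y => ((0 : ℂ), β) +
                  cauchyTransformAlong (1 : ℂ) (fun w => 𝒞.χ₁ w • g w) y) x Complex.I)))) = 0) := by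
  have _ := hr0
  obtain ⟨hu₀s, hu₀J, -, -, hQ₀, hP₀, -, -⟩ := id hu₀
  have hρ₁ := 𝒞.hρ₁
  -- the constant of the quantitative half, and `θ`
  obtain ⟨K, hK, hKb⟩ := helper_memberToZeroAux J R P Q eP eQ hr1.le b₀ u₀ hu₀s 𝒞
  refine ⟨min 1 (ε / (2 * K)), lt_min one_pos (by positivity), ?_⟩
  intro β u hu hβ hC0 hC1 hCr
  have _ := hβ
  generalize hθ : min 1 (ε / (2 * K)) = θ at hC0 hC1 hCr
  have hθ0 : 0 ≤ θ := by rw [← hθ]; exact le_min zero_le_one (by positivity)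
  have hθ1 : θ ≤ 1 := by rw [← hθ]; exact min_le_left _ _
  have hθK : 2 * (K * θ) ≤ ε := by
    rw [← hθ]
    calc 2 * (K * min 1 (ε / (2 * K))) ≤ 2 * (K * (ε / (2 * K))) := by
          gcongr; exact min_le_right _ _
      _ = ε := by field_simp
  obtain ⟨hus, huJ, -, -, hQ, hP, -, -⟩ := id hu
  -- the normal form `wt = Ψ⁻¹ (u - u₀)` and the density `g₀ = ∂̄ wt`
  set wt : ℂ → ℂ × ℂ := fun y => 𝒞.Ψinv y (u y - u₀ y) with hwt_def
  have hwts : ContDiff ℝ ∞ wt := 𝒞.hΨinvs.clm_apply (hus.sub hu₀s)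
  have hwtd : Differentiable ℝ wt := hwts.differentiable (by simp)
  set g₀ : ℂ → ℂ × ℂ := dbarAlong (1 : ℂ) wt with hg₀_def
  have hg₀s : ContDiff ℝ ∞ g₀ := MemberToZero.contDiff_dbar hwts
  -- the conjugated equation for `wt`
  have hΨΨinv : ∀ ξ e, 𝒞.Ψ ξ (𝒞.Ψinv ξ e) = e := fun ξ e => by
    simpa using congrArg (fun M : E4 →L[ℝ] E4 => M e) (𝒞.hright ξ)
  have hurep : ∀ ξ, u₀ ξ + 𝒞.Ψ ξ (wt ξ) = u ξ := fun ξ => by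
    simp only [hwt_def, hΨΨinv]; abel
  have hflat : IsJHolomorphicFlat J (fun ξ => u₀ ξ + 𝒞.Ψ ξ (wt ξ)) := by
    rw [show (fun ξ => u₀ ξ + 𝒞.Ψ ξ (wt ξ)) = u from funext hurep]; exact huJ
  have hconj := (helper_conjugatedEquation J hJs hJ2 u₀ hu₀s hu₀J 𝒞.Ψ 𝒞.Ψinv 𝒞.hΨs 𝒞.hleft
    𝒞.hright 𝒞.hΨJ wt (hwts.of_le (mod_cast le_top))).1 hflat
  have hAx : ∀ x (y : ℂ × ℂ), 𝒞.A x y =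
      𝒞.Ψinv x ((fderiv ℝ 𝒞.Ψ x (1 : ℂ)) y + J (u₀ x) ((fderiv ℝ 𝒞.Ψ x Complex.I) y)) :=
    fun x y => rfl
  -- `g₀` vanishes for `‖x‖ ≥ ρ₁ + 1`
  have hS0 := (𝒞.S_props hR hJs hJ2 hPQ hJP hJQ hu₀s hu₀J).2.2
  have hvan : ∀ x, 𝒞.ρ₁ + 1 ≤ ‖x‖ → g₀ x = 0 := by
    intro x hx
    have hu₀far : R + 1 ≤ ‖u₀ x‖ :=
      (𝒞.hfar x (by linarith)).trans (PencilDefs.norm_P_le hPQ _)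
    have hufar : R ≤ ‖u x‖ := by
      have h1 := norm_sub_norm_le (u₀ x) (u x)
      rw [norm_sub_rev] at h1
      linarith [hC0 x]
    have h := hconj x
    rw [← hAx, 𝒞.A_eq_zero hPQ hJP hJQ hS0 hx, hurep x,
      MemberToZero.J_eq_of_far hPQ hJP hJQ (x := u x) (y := u₀ x) hufar (by linarith),
      sub_self] at h
    simpa using h
  -- the bounds of the quantitative half, membership in `C^{0,r}_b` and the norm
  obtain ⟨hsup, hhol⟩ := hKb θ u hθ0 hus hC0 hC1 hCr hvan
  replace hsup : ∀ x, ‖g₀ x‖ ≤ K * θ := hsup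
  replace hhol : ∀ x x', ‖g₀ x - g₀ x'‖ ≤ K * θ * ‖x - x'‖ ^ (r : ℝ) := hhol
  have hg₀c : HasCompactSupport g₀ := CoreA.hasCompactSupport_of_eq_zero hvan
  have hmem : MemContDiffHolder 0 r g₀ :=
    MemContDiffHolder.of_contDiff_of_hasCompactSupport hg₀s hg₀c hr1.le
  set g : ContDiffHolderFunction ℂ (ℂ × ℂ) 0 r := ⟨g₀, hmem⟩ with hg_def
  have hgcoe : ∀ x, g x = g₀ x := fun x => rfl
  have hnorm : ‖g‖ ≤ ε := by
    have hHW : HolderWith (K * θ).toNNReal r (iteratedFDeriv ℝ 0 (g : ℂ → ℂ × ℂ)) := by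
      rw [holderWith_iteratedFDeriv_zero_iff]
      refine holderWith_of_dist_le fun x x' => ?_
      rw [dist_eq_norm, dist_eq_norm, Real.coe_toNNReal _ (by positivity)]
      exact hhol x x'
    have h := g.norm_le_of_iteratedFDeriv_le (δ := K * θ) (by positivity) ?_ hHW
    · rw [Real.coe_toNNReal _ (by positivity), Nat.cast_zero, zero_add, one_mul] at h
      linarith
    · intro j hj x
      obtain rfl := Nat.le_zero.mp hj
      rw [norm_iteratedFDeriv_zero]
      exact hsup x
  -- `χ₁ • g = g₀` and the Cauchy transform `T g₀`
  have hχg : ∀ w, 𝒞.χ₁ w • g w = g₀ w := by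
    intro w
    rw [hgcoe]
    by_cases hw : ‖w‖ ≤ 𝒞.ρ₁ + 2
    · rw [𝒞.hχ₁_one w hw, one_smul]
    · rw [hvan w (by linarith [not_le.mp hw]), smul_zero]
  set T : ℂ → ℂ × ℂ := cauchyTransformAlong (1 : ℂ) g₀ with hT_def
  have hTg : cauchyTransformAlong (1 : ℂ) (fun w => 𝒞.χ₁ w • g w) = T :=
    congrArg (cauchyTransformAlong (1 : ℂ)) (funext hχg)
  have hTs : ContDiff ℝ ∞ T := contDiff_cauchyTransformAlong hg₀s hg₀c one_ne_zero
  have hTd : Differentiable ℝ T := hTs.differentiable (by simp)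
  have hdbarT : ∀ z, dbarAlong (1 : ℂ) T z = g₀ z :=
    dbarAlong_cauchyTransformAlong (hg₀s.of_le (mod_cast le_top)) hg₀c one_ne_zero
  have hTlim : Tendsto T (cocompact ℂ) (𝓝 0) :=
    tendsto_cauchyTransform_cocompact (R := 𝒞.ρ₁ + 1) (by linarith) hvan hsup
  have hwtlim : Tendsto wt (cocompact ℂ) (𝓝 ((0 : ℂ), β)) :=
    MemberToZero.tendsto_normalForm 𝒞 hPQ hQ hP hQ₀ hP₀
  -- `k := wt - (0, β) - T g₀` is smooth, `∂̄ k = 0`, `k → 0`; Liouville: `k = 0`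
  set k : ℂ → ℂ × ℂ := fun z => wt z - (((0 : ℂ), β) + T z) with hk_def
  have hks : ContDiff ℝ ∞ k := hwts.sub (contDiff_const.add hTs)
  have hklim : Tendsto k (cocompact ℂ) (𝓝 0) := by
    have := (hwtlim.sub_const ((0 : ℂ), β)).sub hTlim
    simpa [hk_def, sub_sub] using this
  have hdbark : ∀ z, dbarAlong (1 : ℂ) k z = 0 := by
    intro z
    have hD : fderiv ℝ k z = fderiv ℝ wt z - fderiv ℝ T z :=
      ((hwtd z).hasFDerivAt.sub ((hTd z).hasFDerivAt.const_add ((0 : ℂ), β))).fderiv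
    have e : dbarAlong (1 : ℂ) k z = dbarAlong (1 : ℂ) wt z - dbarAlong (1 : ℂ) T z := by
      simp only [dbarAlong_apply, hD, FunLike.coe_sub, Pi.sub_apply]
      module
    rw [e, hdbarT]
    exact sub_self _
  have hk0 : k = 0 := MemberToZero.eq_zero_of_dbar_eq_zero hks hdbark hklim
  have hrep : ∀ ξ, ((0 : ℂ), β) + cauchyTransformAlong (1 : ℂ) (fun w => 𝒞.χ₁ w • g w) ξ =
      wt ξ := by
    intro ξ
    rw [hTg]
    have := congrFun hk0 ξ
    simp only [hk_def, Pi.zero_apply, sub_eq_zero] at this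
    exact this.symm
  -- the zero equation (the conjugated equation, divided by two where `χ = 1`)
  have hzero : ∀ W : ℂ → ℂ × ℂ, W = wt → ∀ x, g x + 𝒞.χ x • (1 / 2 : ℝ) •
      (𝒞.A x (W x) + 𝒞.Ψinv x ((J (u₀ x + 𝒞.Ψ x (W x)) - J (u₀ x))
        (fderiv ℝ u₀ x Complex.I + (fderiv ℝ 𝒞.Ψ x Complex.I) (W x) +
          𝒞.Ψ x (fderiv ℝ W x Complex.I)))) = 0 := by
    rintro W rfl x
    have hc := hconj x
    rw [← hAx, add_assoc] at hc
    refine MemberToZero.zero_equation_of hc ?_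
    by_cases hx : ‖x‖ ≤ 𝒞.ρ₁ + 1
    · exact Or.inl (𝒞.hχ_one x hx)
    · exact Or.inr (hvan x (le_of_lt (not_le.mp hx)))
  refine ⟨g, hnorm, fun x hx => hvan x hx, fun x => rfl, fun ξ => ?_, fun x => ?_⟩
  · rw [hrep ξ, hurep ξ]
  · exact hzero (fun y => ((0 : ℂ), β) +
      cauchyTransformAlong (1 : ℂ) (fun w => 𝒞.χ₁ w • g w) y) (funext hrep) x

end Summit.SmoothPoincare4.SmoothPoincare4.Cruxes.TameOrBrodyR4.Sketch

end
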